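import Literature.MathematicalPhysics.KineticTheory.DiPernaLionsLimitTensor
import Literature.MathematicalPhysics.KineticTheory.DiPernaLionsVelocityAverages
import HarnessLib

/-!
# The entropy inequality of the DiPerna–Lions weak limit: assembly, granted velocity averaging

Topic: MathematicalPhysics / KineticTheory. Final layer of the proof of the named fact (B3)
`Literature.MathematicalPhysics.KineticTheory.diPernaLions_limit_entropyInequality`
(DiPerna–Lions 1991; Lions 1993 Thm III.4 with (E) p. 54; Cercignani–Illner–Pulvirenti 1994
§5.3 Step 14, p. 160). The three proved layers

* `IsDiPernaLionsWeakLimit.hasEntropyInequality_of_dissipation_le_liminf`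
  (`DiPernaLionsLimitEntropy`: lower semicontinuity of the entropy and passage to the limit in
  (3.7), given the lower semicontinuity of the dissipation),
* `IsDiPernaLionsWeakLimit.dissipation_le_liminf_of_tensor_limits`
  (`DiPernaLionsLimitDissipation`: lower semicontinuity of the dissipation, given the weak
  convergence of the normalised tensor products),
* `tensor_limits_of_velocityAverages` (`DiPernaLionsLimitTensor`: weak convergence of the
  normalised tensor products, given the strong convergence of the velocity averages),

are combined with the strong convergence of the velocity averages of the approximating sequence
(`tendsto_integral_abs_velocityAverage_sub` of `DiPernaLionsVelocityAverages`, CIP Lemma 5.3.10 /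
Lemma 5.3.11 (i)), which holds granted the velocity-averaging lemma (CIP Lemma 5.3.9, the named
fact `velocityAverage_relativelyCompact_L1` of `VelocityAveraging`). The result is
`diPernaLions_limit_entropyInequality_of_velocityAveraging`: **(B3) holds granted CIP Lemma 5.3.9**.
The discharge `diPernaLions_limit_entropyInequality_holds` is then the one-line application to
`velocityAverage_relativelyCompact_L1_holds`, once that fact is proved.

## References

* R. J. DiPerna, P.-L. Lions, *Global solutions of Boltzmann's equation and the entropy
  inequality*, Arch. Rational Mech. Anal. 114 (1991) 47–55.
* P.-L. Lions, LNM 1551 (1993), Thm III.4 and (E) p. 54.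
* C. Cercignani, R. Illner, M. Pulvirenti, *The Mathematical Theory of Dilute Gases*, Springer
  (1994), §5.3 Lemma 5.3.9–5.3.11 (pp. 154–156), Step 14 (p. 160).
-/

open MeasureTheory Metric Real Set Filter Topology
open scoped InnerProductSpace ENNReal

noncomputable section

namespace Literature.MathematicalPhysics.KineticTheory

section Helpers

variable {α : Type*} [MeasurableSpace α] {μ : Measure α}

/-- Weak `L¹` convergence is invariant under a.e. modification of the sequence. [folklore] -/
theorem _root_.Literature.Analysis.FunctionSpaces.TendstoWeaklyL1.congr_seq {f f' : ℕ → α → ℝ}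
    {g : α → ℝ} (h : Literature.Analysis.FunctionSpaces.TendstoWeaklyL1 f g μ)
    (hff' : ∀ k, f k =ᵐ[μ] f' k) : Literature.Analysis.FunctionSpaces.TendstoWeaklyL1 f' g μ := by
  intro φ C hφ hC
  have : ∀ k, ∫ x, f' k x * φ x ∂μ = ∫ x, f k x * φ x ∂μ := fun k =>
    integral_congr_ae ((hff' k).mono fun x hx => by beta_reduce; rw [hx])
  simp only [this]
  exact h φ C hφ hC

end Helpers

section Assembly

universe u

variable {E : Type u} [NormedAddCommGroup E] [InnerProductSpace ℝ E] [FiniteDimensional ℝ E]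
  [MeasurableSpace E] [BorelSpace E]

/-- The slab measure `(0,T) × E × E` as the product of Lebesgue measure on `(0,T]` with
`dx dv`. [folklore] -/
theorem slabMeasure_eq_restrict_Ioc_prod (T : ℝ) :
    slabMeasure E T = ((volume : Measure ℝ).restrict (Ioc 0 T)).prod
      ((volume : Measure E).prod (volume : Measure E)) := by
  rw [slabMeasure_eq_prod, restrict_Ioo_eq_restrict_Ioc]

/-- The base slab measure `(0,T) × E` as the product of Lebesgue measure on `(0,T]` with `dx`.
[folklore] -/
theorem baseSlabMeasure_eq_restrict_Ioc_prod (T : ℝ) :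
    baseSlabMeasure E T = ((volume : Measure ℝ).restrict (Ioc 0 T)).prod (volume : Measure E) := by
  rw [baseSlabMeasure_def, ← restrict_Ioo_eq_restrict_Ioc,
    ← Measure.restrict_univ (μ := (volume : Measure E)), Measure.prod_restrict]
  rfl

/-- **(B3) granted the velocity-averaging lemma**: the entropy inequality
`H(f(t)) + ∫₀ᵗ∫ D_B(f) dx ds ≤ H(f(0))` of the DiPerna–Lions weak limit
(`diPernaLions_limit_entropyInequality`; DiPerna–Lions 1991; Lions 1993 Thm III.4 (E);
CIP 1994 §5.3 Step 14, p. 160) follows from CIP Lemma 5.3.9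
(`velocityAverage_relativelyCompact_L1`): the velocity averages of the approximating sequence
converge strongly (`tendsto_integral_abs_velocityAverage_sub`), hence the normalised tensor
products converge weakly on the energy shells (`tensor_limits_of_velocityAverages`), hence the
entropy dissipation is lower semicontinuous along the sequence
(`IsDiPernaLionsWeakLimit.dissipation_le_liminf_of_tensor_limits`), hence the entropy inequality
passes to the limit (`IsDiPernaLionsWeakLimit.hasEntropyInequality_of_dissipation_le_liminf`). [cite: CIPDiluteGases1994, §5.3 Step 14 (p. 160)]
[cite: Lions1993Kinetic, Thm III.4 (p. 57) and (E) (p. 54)] -/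
theorem diPernaLions_limit_entropyInequality_of_velocityAveraging
    (h9 : velocityAverage_relativelyCompact_L1.{u}) : diPernaLions_limit_entropyInequality.{u} := by
  intro E _ _ _ _ _ B hB f₀ hf₀ δ Bseq fseq hδ hanti hlim hker hdata hsol hbd φ f hW
  haveI := Literature.Analysis.FluidPDE.isFiniteMeasure_sphereMeasure (E := E)
  refine hW.hasEntropyInequality_of_dissipation_le_liminf hB hdata hsol hbd fun t ht => ?_
  -- the measures of collision phase space over `(0, t]`
  set μ₁ : Measure (ℝ × E) := ((volume : Measure ℝ).restrict (Ioc 0 t)).prod (volume : Measure E)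
    with hμ₁
  set μ₂ : Measure ((E × E) × sphere (0 : E) 1) :=
    ((volume : Measure E).prod volume).prod KineticTheory.sphereMeasure with hμ₂
  set ν : Measure ((ℝ × E) × ((E × E) × sphere (0 : E) 1)) := μ₁.prod μ₂ with hν
  set μZ : Measure (ℝ × E × E) := ((volume : Measure ℝ).restrict (Ioc 0 t)).prod
    ((volume : Measure E).prod (volume : Measure E)) with hμZ
  have hae_s : ∀ᵐ ω ∂ν, ω.1.1 ∈ Ioc 0 t := by
    have h1 : ∀ᵐ p ∂μ₁, p.1 ∈ Ioc 0 t :=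
      (Measure.quasiMeasurePreserving_fst (μ := (volume : Measure ℝ).restrict (Ioc 0 t))
        (ν := (volume : Measure E))).ae (ae_restrict_mem measurableSet_Ioc)
    exact (Measure.quasiMeasurePreserving_fst (μ := μ₁) (ν := μ₂)).ae h1
  have hae_z : ∀ᵐ z ∂μZ, z.1 ∈ Ioc 0 t :=
    (Measure.quasiMeasurePreserving_fst (μ := (volume : Measure ℝ).restrict (Ioc 0 t))
      (ν := (volume : Measure E).prod (volume : Measure E))).ae (ae_restrict_mem measurableSet_Ioc)
  have hae_p : ∀ᵐ p ∂μ₁, p.1 ∈ Ioc 0 t :=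
    (Measure.quasiMeasurePreserving_fst (μ := (volume : Measure ℝ).restrict (Ioc 0 t))
      (ν := (volume : Measure E))).ae (ae_restrict_mem measurableSet_Ioc)
  -- the approximate solutions along `φ`, extended measurably to negative times
  set g : ℕ → ℝ → E → E → ℝ := fun k s x v => fseq (φ k) (max s 0) x v with hg
  have hgm : ∀ k, Measurable fun z : ℝ × E × E => g k z.1 z.2.1 z.2.2 := by
    intro k
    have hc : Continuous fun z : ℝ × E × E => ((max z.1 0, z.2) : ℝ × E × E) :=
      (continuous_fst.max continuous_const).prodMk continuous_snd
    exact ((hsol (φ k)).continuousOn_uncurry.comp_continuous hc fun z =>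
      mk_mem_prod (mem_Ici.2 (le_max_right _ _)) (mem_univ _)).measurable
  have hg0 : ∀ k s x v, 0 ≤ g k s x v := fun k s x v =>
    (hsol (φ k)).nonneg _ (le_max_right _ _) _ _
  have hg_eq : ∀ k, ∀ s ∈ Ioc 0 t, ∀ x v, g k s x v = fseq (φ k) s x v := fun k s hs x v => by
    simp only [hg, max_eq_left hs.1.le]
  -- the uniform bounds
  obtain ⟨Cm, hCm⟩ := hbd.massEntropy_le t ht.le
  obtain ⟨Cl, hCl⟩ := hW.massEntropy_le t ht.le
  have hCg : ∀ k, ∀ s ∈ Ioc 0 t, ∫⁻ z : E × E, ENNReal.ofReal (g k s z.1 z.2 *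
      (1 + ‖z.1‖ ^ 2 + ‖z.2‖ ^ 2 + |log (g k s z.1 z.2)|)) ∂((volume : Measure E).prod volume) ≤
      ENNReal.ofReal (max Cm Cl) := by
    intro k s hs
    simp only [hg_eq k s hs]
    exact (hCm (φ k) s ⟨hs.1.le, hs.2⟩).trans (ENNReal.ofReal_le_ofReal (le_max_left _ _))
  have hCf : ∀ s ∈ Ioc 0 t, ∫⁻ z : E × E, ENNReal.ofReal |f s z.1 z.2|
      ∂((volume : Measure E).prod volume) ≤ ENNReal.ofReal (max Cm Cl) := by
    intro s hs
    refine le_trans (lintegral_mono fun z => ENNReal.ofReal_le_ofReal ?_)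
      ((hCl s ⟨hs.1.le, hs.2⟩).trans (ENNReal.ofReal_le_ofReal (le_max_right _ _)))
    rw [abs_of_nonneg (hW.nonneg s hs.1.le _ _)]
    refine le_mul_of_one_le_right (hW.nonneg s hs.1.le _ _) ?_
    nlinarith [sq_nonneg ‖z.1‖, sq_nonneg ‖z.2‖, abs_nonneg (log (f s z.1 z.2))]
  -- weak convergence, equi-integrability and tightness on the slab `(0, t] × E × E`
  have hslab_ae : ∀ k, (fun z : ℝ × E × E => fseq (φ k) z.1 z.2.1 z.2.2) =ᵐ[μZ]
      fun z => g k z.1 z.2.1 z.2.2 := fun k => by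
    filter_upwards [hae_z] with z hz
    exact (hg_eq k z.1 hz _ _).symm
  have hwslab : Literature.Analysis.FunctionSpaces.TendstoWeaklyL1 (fun k (z : ℝ × E × E) => g k z.1 z.2.1 z.2.2)
      (fun z => f z.1 z.2.1 z.2.2) μZ := by
    have h := hW.tendstoWeaklyL1_slab t
    rw [slabMeasure_eq_restrict_Ioc_prod] at h
    exact h.congr_seq hslab_ae
  obtain ⟨hUI0, hUT0⟩ := uniformIntegrable_unifTight_slab hsol hbd t
  have hUI : UnifIntegrable (fun k (z : ℝ × E × E) => g k z.1 z.2.1 z.2.2) 1 μZ := by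
    have h := (uniformIntegrable_comp_subseq hUI0 φ).2.1
    rw [slabMeasure_eq_restrict_Ioc_prod] at h
    exact h.ae_eq fun k => hslab_ae k
  have hUT : UnifTight (fun k (z : ℝ × E × E) => g k z.1 z.2.1 z.2.2) 1 μZ := by
    have h := unifTight_comp_subseq hUT0 φ
    rw [slabMeasure_eq_restrict_Ioc_prod] at h
    exact h.aeeq fun k => hslab_ae k
  -- the strong convergence of the velocity averages (CIP Lemma 5.3.10–5.3.11, granted Lemma 5.3.9)
  have hN4 : ∀ θ : ℝ × E × E → ℝ, Measurable θ → ∀ M : ℝ, (∀ z, |θ z| ≤ M) →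
      Tendsto (fun k => ∫ p, |(∫ w, g k p.1 p.2 w * θ (p.1, p.2, w)) -
          ∫ w, f p.1 p.2 w * θ (p.1, p.2, w)| ∂μ₁) atTop (𝓝 0) := by
    intro θ hθm M hM
    have h := tendsto_integral_abs_velocityAverage_sub h9 hB hf₀ hδ hanti hlim hker hdata hsol hbd hW
      (T := t) (ψ := fun _ => θ) (ψlim := θ) (M := M) (fun _ => hθm.aestronglyMeasurable)
      (fun _ => ae_of_all _ fun z => hM z) (ae_of_all _ fun _ => tendsto_const_nhds)
    rw [baseSlabMeasure_eq_restrict_Ioc_prod] at h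
    refine h.congr fun k => integral_congr_ae ?_
    filter_upwards [hae_p] with p hp
    simp only [velocityIntegral, hg_eq k p.1 hp]
  -- the tensor limits at every level `N`
  have key : ∀ N : ℕ, _ := fun N : ℕ =>
    tensor_limits_of_velocityAverages hgm hg0 hW.measurable (fun s hs => hW.nonneg s hs.le) hCg hCf
      hwslab hUI hUT hN4 (inv_pos.2 (by positivity : (0 : ℝ) < (N : ℝ) + 1))
      (by positivity : (0 : ℝ) ≤ (N : ℝ) + 1)
  -- transfer from `g` back to `fseq ∘ φ` on collision phase space
  have hP_ae : ∀ (N k : ℕ), (fun ω : (ℝ × E) × ((E × E) × sphere (0 : E) 1) =>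
      (1 + ((N : ℝ) + 1)⁻¹ * ∫ w, |g k ω.1.1 ω.1.2 w|)⁻¹ * (g k ω.1.1 ω.1.2 ω.2.1.1 * g k ω.1.1 ω.1.2 ω.2.1.2))
      =ᵐ[ν] fun ω => (1 + ((N : ℝ) + 1)⁻¹ * ∫ w, |fseq (φ k) ω.1.1 ω.1.2 w|)⁻¹ *
        (fseq (φ k) ω.1.1 ω.1.2 ω.2.1.1 * fseq (φ k) ω.1.1 ω.1.2 ω.2.1.2) := fun N k => by
    filter_upwards [hae_s] with ω hω
    simp only [hg_eq k ω.1.1 hω]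
  refine hW.dissipation_le_liminf_of_tensor_limits hB hδ hlim hker hsol hbd ht (fun N => ?_) (fun N => ?_)
  · exact (key N).1.congr_seq fun k => ae_restrict_of_ae (hP_ae N k)
  · intro ψ M hψm hψbd hψlim
    refine ((key N).2 ψ M hψm hψbd hψlim).congr fun k => integral_congr_ae ?_
    filter_upwards [ae_restrict_of_ae (hP_ae N k)] with ω hω
    rw [hω]

end Assembly

end Literature.MathematicalPhysics.KineticTheory
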